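import Mathlib
import HarnessLib

/-!
# Crux `FiniteTangentModuliMild` (stmt-NavierStokesRegularity-14049), line `packing-observability`:
STUB 2

The PACKING REDUCTION for an abstract linear class `P` of velocity fields on `(−∞,0) × ℝ³` — the
registered stub `stub_packing` of the line's skeleton
(`Cruxes/FiniteTangentModuliMild/Lines/packing-observability.lean`). Helper file for the crux item
(lands `--supports stmt-NavierStokesRegularity-14049`). Pure functional analysis (Riesz lemma +
Arzelà–Ascoli); no fluid mechanics.

## Statement

If `P` contains `0`, is closed under linear combinations, its members are continuous on `t < 0` with
a tempered envelope `K · w(t)`, `w(t) = 1/√(−t) + 1/(−t)`, are OBSERVABLE from the compact cylinder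
`Q_R = [−2,−1] × B̄_R` with constant `M` (`‖v(t,x)‖ ≤ M w(t) sup_{Q_R} ‖v‖` for all `t < 0`, `x`),
and a member with envelope constant `K` has modulus of continuity `K ω` on `Q_R` (`ω → 0` at `0⁺`),
then for some `N` any `N + 1` members are linearly dependent on `t < 0`.

## Proof sketch

Let `D = {p : ℝ × ℝ³ // p.1 < 0}` and `W ⊆ (D → ℝ³)` the set of restrictions of members: a submodule
(zero + linear closure). Restriction to the compact cylinder `Q_R` (continuity on `t < 0`) is a
linear map `T : W → (Q_R →ᵇ ℝ³)` into bounded continuous functions; it is INJECTIVE because a member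
vanishing on `Q_R` has `sSup` of its image equal to `0`, so observability kills it on all of
`t < 0`.
The range of `T` is finite-dimensional: otherwise the Riesz lemma
(`exists_seq_norm_le_one_le_norm_sub`) gives a bounded `1`-separated sequence in it; but every `g`
in the range with `‖g‖ ≤ r` takes values in the compact ball `closedBall 0 r ⊆ ℝ³` and
(observability gives the envelope constant `K = M r`, then the modulus hypothesis) satisfies
`dist (g p) (g p') ≤ M r ω(dist p p')`; this family is equicontinuous since `ω → 0⁺`, so by
`BoundedContinuousFunction.arzela_ascoli` its closure is compact and the sequence has a convergent
subsequence — contradiction. Hence `W ≃ range T` is finite-dimensional; with `N := finrank ℝ W`, any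
`N + 1` members restrict to a linearly dependent family in `W`
(`LinearIndependent.fintype_card_le_finrank`), i.e. `∑ cᵢ vᵢ = 0` on `t < 0` with `c ≠ 0`.
-/

noncomputable section

open Set Function Filter Topology Metric
open scoped BigOperators BoundedContinuousFunction

set_option linter.dupNamespace false

namespace Summit.NavierStokesRegularity.NavierStokesRegularity.Theorems

/-- Local notation for physical space `ℝ³ = EuclideanSpace ℝ (Fin 3)` (as in the skeleton). -/
local notation "ℝ³" => EuclideanSpace ℝ (Fin 3)

/-- **Arzelà–Ascoli packing step.** On a compact metric space, a sequence of bounded continuous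
functions with values in a fixed ball of a proper normed space and a common modulus of continuity
`C ω` (`ω → 0` at `0⁺`) contains two distinct indices at sup-distance `< 1`: the family is
equicontinuous with values in a compact set, so its closure is compact
(`BoundedContinuousFunction.arzela_ascoli`) and a subsequence converges. -/
theorem stub_packing_near_pair {α : Type*} [MetricSpace α] [CompactSpace α]
    {E : Type*} [NormedAddCommGroup E] [ProperSpace E]
    {C r : ℝ} (hC : 0 < C) {om : ℝ → ℝ} (hom : Tendsto om (𝓝[>] 0) (𝓝 0))
    (g : ℕ → α →ᵇ E)
    (hb : ∀ n p, g n p ∈ Metric.closedBall (0 : E) r)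
    (hm : ∀ n p p', dist (g n p) (g n p') ≤ C * om (dist p p')) :
    ∃ m n, m ≠ n ∧ ‖g m - g n‖ < 1 := by
  set A : Set (α →ᵇ E) :=
    {f | (∀ p, f p ∈ Metric.closedBall (0 : E) r) ∧
      ∀ p p', dist (f p) (f p') ≤ C * om (dist p p')}
  have hgA : ∀ n, g n ∈ A := fun n => ⟨hb n, hm n⟩
  have hcpt : IsCompact (closure A) := by
    refine BoundedContinuousFunction.arzela_ascoli (Metric.closedBall 0 r)
      (isCompact_closedBall 0 r) A (fun f p hf => hf.1 p) ?_
    intro x₀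
    rw [Metric.equicontinuousAt_iff]
    intro ε hε
    obtain ⟨δ, hδ, hδ'⟩ := Metric.tendsto_nhdsWithin_nhds.1 hom (ε / C) (div_pos hε hC)
    refine ⟨δ, hδ, fun x hx f => ?_⟩
    obtain ⟨f, hf⟩ := f
    show dist (f x₀) (f x) < ε
    by_cases hxx : x = x₀
    · subst hxx
      simpa using hε
    · have hd : 0 < dist x₀ x := dist_pos.2 (Ne.symm hxx)
      have h1 : dist (dist x₀ x) 0 < δ := by
        rw [Real.dist_eq, sub_zero, abs_of_pos hd, dist_comm]
        exact hx
      have h2 := hδ' (Set.mem_Ioi.2 hd) h1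
      rw [Real.dist_eq, sub_zero] at h2
      calc dist (f x₀) (f x) ≤ C * om (dist x₀ x) := hf.2 x₀ x
        _ ≤ C * |om (dist x₀ x)| := mul_le_mul_of_nonneg_left (le_abs_self _) hC.le
        _ < C * (ε / C) := mul_lt_mul_of_pos_left h2 hC
        _ = ε := by field_simp
  obtain ⟨a, -, φ, hφ, hlim⟩ := hcpt.tendsto_subseq fun n => subset_closure (hgA n)
  obtain ⟨N₀, hN₀⟩ := Metric.tendsto_atTop.1 hlim (1 / 2) (by norm_num)
  have h1 : dist (g (φ N₀)) a < 1 / 2 := hN₀ N₀ le_rfl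
  have h2 : dist (g (φ (N₀ + 1))) a < 1 / 2 := hN₀ (N₀ + 1) (Nat.le_succ _)
  refine ⟨φ N₀, φ (N₀ + 1), fun h => ?_, ?_⟩
  · have h' := hφ.injective h
    omega
  · rw [← dist_eq_norm]
    calc dist (g (φ N₀)) (g (φ (N₀ + 1))) ≤ dist (g (φ N₀)) a + dist (g (φ (N₀ + 1))) a :=
          dist_triangle_right _ _ _
      _ < 1 / 2 + 1 / 2 := add_lt_add h1 h2
      _ = 1 := by norm_num

/-- The restrictions to `t < 0` of the members of a class `P ∋ 0` closed under linear combinations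
form a submodule of all maps `{t < 0} → E`. -/
theorem stub_packing_submodule {E : Type*} [NormedAddCommGroup E] [NormedSpace ℝ E]
    (P : (ℝ → E → E) → Prop) (hP0 : P fun _ _ => 0)
    (hPlin : ∀ (v₁ v₂ : ℝ → E → E) (a b : ℝ), P v₁ → P v₂ →
      P fun t x => a • v₁ t x + b • v₂ t x) :
    ∃ W : Submodule ℝ ({p : ℝ × E // p.1 < 0} → E),
      ∀ f, f ∈ W ↔ ∃ v, P v ∧ f = fun p => v p.1.1 p.1.2 := by
  refine ⟨{ carrier := {f | ∃ v, P v ∧ f = fun p => v p.1.1 p.1.2}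
            add_mem' := ?_
            zero_mem' := ⟨fun _ _ => 0, hP0, funext fun _ => rfl⟩
            smul_mem' := ?_ }, fun f => Iff.rfl⟩
  · rintro _ _ ⟨v₁, hv₁, rfl⟩ ⟨v₂, hv₂, rfl⟩
    refine ⟨fun t x => (1 : ℝ) • v₁ t x + (1 : ℝ) • v₂ t x, hPlin v₁ v₂ 1 1 hv₁ hv₂, ?_⟩
    funext p
    simp
  · rintro c _ ⟨v, hv, rfl⟩
    refine ⟨fun t x => c • v t x + (0 : ℝ) • (fun (_ : ℝ) (_ : E) => (0 : E)) t x,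
      hPlin v _ c 0 hv hP0, ?_⟩
    funext p
    simp

/-- Restriction to a compact set `S ⊆ {t < 0}` is a linear map from the submodule of restricted
members (continuous on `t < 0`) into the bounded continuous functions on `S`. -/
theorem stub_packing_restrict {E : Type*} [NormedAddCommGroup E] [NormedSpace ℝ E]
    {P : (ℝ → E → E) → Prop} {S : Set (ℝ × E)} (hSc : IsCompact S) (hS : ∀ p ∈ S, p.1 < 0)
    (W : Submodule ℝ ({p : ℝ × E // p.1 < 0} → E))
    (hW : ∀ f, f ∈ W ↔ ∃ v, P v ∧ f = fun p => v p.1.1 p.1.2)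
    (hPcont : ∀ v, P v → ContinuousOn (Function.uncurry v) (Set.Iio 0 ×ˢ Set.univ)) :
    ∃ T : W →ₗ[ℝ] (S →ᵇ E),
      ∀ (w : W) (q : S), T w q = (w : {p : ℝ × E // p.1 < 0} → E) ⟨q.1, hS q.1 q.2⟩ := by
  have hcpt : CompactSpace S := isCompact_iff_compactSpace.1 hSc
  have hWcont : ∀ w : W,
      Continuous fun q : S => (w : {p : ℝ × E // p.1 < 0} → E) ⟨q.1, hS q.1 q.2⟩ := by
    intro w
    obtain ⟨v, hv, hwv⟩ := (hW w.1).1 w.2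
    rw [hwv]
    exact (hPcont v hv).comp_continuous continuous_subtype_val
      fun q => Set.mem_prod.2 ⟨hS q.1 q.2, Set.mem_univ _⟩
  exact ⟨{ toFun := fun w => BoundedContinuousFunction.mkOfCompact ⟨_, hWcont w⟩
           map_add' := fun w₁ w₂ => BoundedContinuousFunction.ext fun q => rfl
           map_smul' := fun c w => BoundedContinuousFunction.ext fun q => rfl },
    fun w q => rfl⟩

/-- OBSERVABILITY from a nonempty set `S` makes the restriction map `T` injective: a member
vanishing on `S` has `sSup` of its image there equal to `0`, hence vanishes for all `t < 0`. -/
theorem stub_packing_injective {E : Type*} [NormedAddCommGroup E] [NormedSpace ℝ E]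
    {P : (ℝ → E → E) → Prop} {S : Set (ℝ × E)} (hS : ∀ p ∈ S, p.1 < 0) (hSne : S.Nonempty)
    {M : ℝ} {W : Submodule ℝ ({p : ℝ × E // p.1 < 0} → E)}
    (hW : ∀ f, f ∈ W ↔ ∃ v, P v ∧ f = fun p => v p.1.1 p.1.2) {T : W →ₗ[ℝ] (S →ᵇ E)}
    (hT : ∀ (w : W) (q : S), T w q = (w : {p : ℝ × E // p.1 < 0} → E) ⟨q.1, hS q.1 q.2⟩)
    (hPobs : ∀ v, P v → ∀ t < 0, ∀ x, ‖v t x‖ ≤ M * (1 / Real.sqrt (-t) + 1 / (-t)) *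
      sSup ((fun p : ℝ × E => ‖v p.1 p.2‖) '' S)) :
    Function.Injective T := by
  refine (injective_iff_map_eq_zero T).2 fun w hw => ?_
  obtain ⟨v, hv, hwv⟩ := (hW w.1).1 w.2
  have h0 : ∀ p ∈ S, v p.1 p.2 = 0 := fun p hp => by
    have h := hT w ⟨p, hp⟩
    rw [hw, hwv] at h
    simpa using h.symm
  have himg : (fun p : ℝ × E => ‖v p.1 p.2‖) '' S = {0} :=
    Set.eq_singleton_iff_nonempty_unique_mem.2
      ⟨hSne.image _, by rintro _ ⟨p, hp, rfl⟩; simp [h0 p hp]⟩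
  apply Subtype.ext
  rw [hwv, Submodule.coe_zero]
  funext p
  have h := hPobs v hv p.1.1 p.2 p.1.2
  rw [himg, csSup_singleton, mul_zero] at h
  exact norm_le_zero_iff.1 h

/-- The range of the restriction map `T` is finite-dimensional: otherwise the Riesz lemma gives a
bounded `1`-separated sequence in it, while (observability ⇒ envelope constant `M r`, then the
uniform modulus) its elements of norm `≤ r` form an equicontinuous family with values in a compact
ball, contradicting `stub_packing_near_pair`. -/
theorem stub_packing_finiteRange {E : Type*} [NormedAddCommGroup E] [NormedSpace ℝ E]
    [ProperSpace E] {P : (ℝ → E → E) → Prop} {S : Set (ℝ × E)} (hSc : IsCompact S)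
    (hS : ∀ p ∈ S, p.1 < 0) (hSne : S.Nonempty) {M : ℝ} (hM : 0 < M) {om : ℝ → ℝ}
    (hom : Tendsto om (𝓝[>] 0) (𝓝 0)) {W : Submodule ℝ ({p : ℝ × E // p.1 < 0} → E)}
    (hW : ∀ f, f ∈ W ↔ ∃ v, P v ∧ f = fun p => v p.1.1 p.1.2) {T : W →ₗ[ℝ] (S →ᵇ E)}
    (hT : ∀ (w : W) (q : S), T w q = (w : {p : ℝ × E // p.1 < 0} → E) ⟨q.1, hS q.1 q.2⟩)
    (hPobs : ∀ v, P v → ∀ t < 0, ∀ x, ‖v t x‖ ≤ M * (1 / Real.sqrt (-t) + 1 / (-t)) *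
      sSup ((fun p : ℝ × E => ‖v p.1 p.2‖) '' S))
    (hPmod : ∀ v (K : ℝ), P v → (∀ t < 0, ∀ x, ‖v t x‖ ≤ K * (1 / Real.sqrt (-t) + 1 / (-t))) →
      ∀ p ∈ S, ∀ p' ∈ S, ‖v p.1 p.2 - v p'.1 p'.2‖ ≤ K * om (dist p p')) :
    FiniteDimensional ℝ (LinearMap.range T) := by
  have himg_ne : ∀ v : ℝ → E → E, ((fun p : ℝ × E => ‖v p.1 p.2‖) '' S).Nonempty :=
    fun v => hSne.image _
  have hcpt : CompactSpace S := isCompact_iff_compactSpace.1 hSc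
  by_contra hinf
  obtain ⟨R₁, f, hR₁, hfR, hsep⟩ :=
    exists_seq_norm_le_one_le_norm_sub (𝕜 := ℝ) (E := LinearMap.range T) (by exact hinf)
  have key : ∀ n, (∀ q, (f n : S →ᵇ E) q ∈ Metric.closedBall (0 : E) R₁) ∧
      ∀ q q', dist ((f n : S →ᵇ E) q) ((f n : S →ᵇ E) q') ≤ M * R₁ * om (dist q q') := by
    intro n
    obtain ⟨w, hw⟩ := LinearMap.mem_range.1 (f n).2
    obtain ⟨v, hv, hwv⟩ := (hW w.1).1 w.2
    have hval : ∀ q : S, (f n : S →ᵇ E) q = v q.1.1 q.1.2 := fun q => by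
      rw [← hw, hT, hwv]
    have hptw : ∀ q : S, ‖v q.1.1 q.1.2‖ ≤ R₁ := fun q => by
      rw [← hval q]
      exact ((f n : S →ᵇ E).norm_coe_le_norm q).trans (hfR n)
    refine ⟨fun q => ?_, fun q q' => ?_⟩
    · rw [Metric.mem_closedBall, dist_zero_right, hval q]
      exact hptw q
    · have hsup : sSup ((fun p : ℝ × E => ‖v p.1 p.2‖) '' S) ≤ R₁ :=
        csSup_le (himg_ne v) (by rintro _ ⟨p, hp, rfl⟩; exact hptw ⟨p, hp⟩)
      have henv : ∀ t < 0, ∀ x, ‖v t x‖ ≤ M * R₁ * (1 / Real.sqrt (-t) + 1 / (-t)) := by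
        intro t ht x
        have hwpos : 0 ≤ 1 / Real.sqrt (-t) + 1 / (-t) :=
          add_nonneg (one_div_nonneg.2 (Real.sqrt_nonneg _)) (one_div_nonneg.2 (by linarith))
        calc ‖v t x‖ ≤ M * (1 / Real.sqrt (-t) + 1 / (-t)) *
              sSup ((fun p : ℝ × E => ‖v p.1 p.2‖) '' S) := hPobs v hv t ht x
          _ ≤ M * (1 / Real.sqrt (-t) + 1 / (-t)) * R₁ :=
              mul_le_mul_of_nonneg_left hsup (mul_nonneg hM.le hwpos)
          _ = M * R₁ * (1 / Real.sqrt (-t) + 1 / (-t)) := by ring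
      have h := hPmod v (M * R₁) hv henv q.1 q.2 q'.1 q'.2
      rw [dist_eq_norm, hval q, hval q']
      exact h
  obtain ⟨m, n, hmn, hd⟩ := stub_packing_near_pair (C := M * R₁) (r := R₁)
    (mul_pos hM (by linarith)) hom (fun n => (f n : S →ᵇ E)) (fun n => (key n).1)
    (fun n => (key n).2)
  have h : 1 ≤ ‖f m - f n‖ := hsep hmn
  rw [Submodule.coe_norm, Submodule.coe_sub] at h
  exact (not_lt.2 h) hd

/-- **Packing reduction (registered stub `stub_packing` of line `packing-observability`, crux
stmt-NavierStokesRegularity-14049).** For an abstract class `P` of velocity fields on `(−∞,0) × ℝ³`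
containing `0`, closed under linear combinations, with members continuous on `t < 0` and tempered
(`‖v(t,x)‖ ≤ K (1/√(−t) + 1/(−t))`), observable from the cylinder `[−2,−1] × B̄_R` with constant
`M`, and uniformly equicontinuous there after normalisation (modulus `K ω`, `ω → 0` at `0⁺`): for
some `N`, any `N + 1` members are linearly dependent on `t < 0`. -/
theorem stub_packing : ∀ (P : (ℝ → ℝ³ → ℝ³) → Prop) (R M : ℝ) (om : ℝ → ℝ), 0 < R → 0 < M →
    Tendsto om (𝓝[>] 0) (𝓝 0) →
    P (fun _ _ => 0) →
    (∀ (v₁ v₂ : ℝ → ℝ³ → ℝ³) (a b : ℝ), P v₁ → P v₂ → P fun t x => a • v₁ t x + b • v₂ t x) →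
    (∀ v, P v → ContinuousOn (Function.uncurry v) (Set.Iio 0 ×ˢ Set.univ)) →
    (∀ v, P v → ∃ K : ℝ, ∀ t < 0, ∀ x, ‖v t x‖ ≤ K * (1 / Real.sqrt (-t) + 1 / (-t))) →
    (∀ v, P v → ∀ t < 0, ∀ x, ‖v t x‖ ≤ M * (1 / Real.sqrt (-t) + 1 / (-t)) *
      sSup ((fun p : ℝ × ℝ³ => ‖v p.1 p.2‖) ''
        (Set.Icc (-2 : ℝ) (-1) ×ˢ Metric.closedBall (0 : ℝ³) R))) →
    (∀ v (K : ℝ), P v → (∀ t < 0, ∀ x, ‖v t x‖ ≤ K * (1 / Real.sqrt (-t) + 1 / (-t))) →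
      ∀ p ∈ Set.Icc (-2 : ℝ) (-1) ×ˢ Metric.closedBall (0 : ℝ³) R,
        ∀ p' ∈ Set.Icc (-2 : ℝ) (-1) ×ˢ Metric.closedBall (0 : ℝ³) R,
          ‖v p.1 p.2 - v p'.1 p'.2‖ ≤ K * om (dist p p')) →
    ∃ N : ℕ, ∀ v : Fin (N + 1) → ℝ → ℝ³ → ℝ³, (∀ i, P (v i)) →
      ∃ c : Fin (N + 1) → ℝ, c ≠ 0 ∧ ∀ t < 0, ∀ x, ∑ i, c i • v i t x = 0 := by
  intro P R M om hR hM hom hP0 hPlin hPcont _hPenv hPobs hPmod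
  have hS : ∀ p ∈ Set.Icc (-2 : ℝ) (-1) ×ˢ Metric.closedBall (0 : ℝ³) R,
      p.1 < 0 :=
    fun p hp => lt_of_le_of_lt (Set.mem_prod.1 hp).1.2 (by norm_num)
  have hSne : (Set.Icc (-2 : ℝ) (-1) ×ˢ
      Metric.closedBall (0 : ℝ³) R).Nonempty :=
    ⟨((-1 : ℝ), 0), Set.mk_mem_prod ⟨by norm_num, by norm_num⟩ (Metric.mem_closedBall_self hR.le)⟩
  have hSc : IsCompact (Set.Icc (-2 : ℝ) (-1) ×ˢ
      Metric.closedBall (0 : ℝ³) R) :=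
    isCompact_Icc.prod (isCompact_closedBall 0 R)
  obtain ⟨W, hW⟩ := stub_packing_submodule P hP0 hPlin
  obtain ⟨T, hT⟩ := stub_packing_restrict hSc hS W hW hPcont
  have hTinj : Function.Injective T := stub_packing_injective hS hSne hW hT hPobs
  have hfin : FiniteDimensional ℝ (LinearMap.range T) :=
    stub_packing_finiteRange hSc hS hSne hM hom hW hT hPobs hPmod
  have hWfin : Module.Finite ℝ W := Module.Finite.equiv (LinearEquiv.ofInjective T hTinj).symm
  refine ⟨Module.finrank ℝ W, fun v hv => ?_⟩
  obtain ⟨g, hg⟩ : ∃ g : Fin (Module.finrank ℝ W + 1) → W,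
      ∀ i, (g i : {p : ℝ × ℝ³ // p.1 < 0} → ℝ³) =
        fun p => v i p.1.1 p.1.2 :=
    ⟨fun i => ⟨fun p => v i p.1.1 p.1.2, (hW _).2 ⟨v i, hv i, rfl⟩⟩, fun i => rfl⟩
  have hli : ¬LinearIndependent ℝ g := fun h => by
    have h' := h.fintype_card_le_finrank
    rw [Fintype.card_fin] at h'
    omega
  obtain ⟨c, hc, i, hi⟩ := Fintype.not_linearIndependent_iff.1 hli
  refine ⟨c, fun h => hi (by simp [h]), fun t ht x => ?_⟩
  have h := congrArg
    (fun w : W => (w : {p : ℝ × ℝ³ // p.1 < 0} → ℝ³)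
      ⟨(t, x), ht⟩) hc
  simpa [Submodule.coe_sum, Finset.sum_apply, hg] using h

end Summit.NavierStokesRegularity.NavierStokesRegularity.Theorems

end
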